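import Literature.Computability.Cryptography.SequenceProblems
import HarnessLib

/-!
# Edit distance: symmetry, one-symbol perturbations, concatenation, splitting, reversal

Elementary facts about the Levenshtein distance `editDist` of
`Literature.Computability.Cryptography.SequenceProblems` (unit-cost insertions, deletions,
substitutions; defined by the Wagner–Fischer recursion on the heads of the lists), proved from
the recursion alone. They are the generic tools used in the SETH-hardness proof for binary edit
distance (Bringmann–Künnemann, FOCS 2015, §5.2, "Facts 5.5–5.7") and discharge the named fact
`editDist_comm` of `SequenceProblems`:

* `editDist_comm_holds` — symmetry (Wagner–Fischer 1974, §2);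
* one-symbol perturbations: `editDist_cons_left_le`, `editDist_cons_right_le`,
  `editDist_le_cons_left`, `editDist_le_cons_right` (adding or removing one symbol changes the
  distance by at most `1`; BK15 Fact 5.5(3) for one symbol), `editDist_cons_cons_same` and
  `editDist_append_left_cancel` (a common prefix can be matched greedily; BK15 Fact 5.5(1)),
  the length bounds `length_le_editDist_add_length_left/right` (BK15 Fact 5.5(2));
* concatenation: `editDist_append_append_le` (traversals concatenate:
  `editDist (x₁ ++ x₂) (y₁ ++ y₂) ≤ editDist x₁ y₁ + editDist x₂ y₂`), `editDist_append_left_le`,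
  `editDist_append_right_le`, and BK15 Fact 5.5(3) (appending / removing a suffix `z` changes the
  distance by at most `|z|`): `editDist_append_le_add_length`,
  `editDist_le_editDist_append_add_length`;
* splitting (BK15 Fact 5.7, the converse of concatenation): `exists_split_editDist_le` — for
  every `x, y₁, y₂` there is a decomposition `x = x₁ ++ x₂` with
  `editDist x₁ y₁ + editDist x₂ y₂ ≤ editDist x (y₁ ++ y₂)` — and its iterated form
  `exists_splits_editDist_le` for a list of blocks `y₁ ⋯ y_k`;
* the recursion at the *ends* of the lists (`editDist_concat_concat`) and reversal invariance
  (`editDist_reverse`), which turn every "prefix" statement into the corresponding "suffix"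
  statement ("we obtain symmetric statements by reversing all involved strings", BK15 §5.2).

## References

* R. A. Wagner, M. J. Fischer, *The string-to-string correction problem*, J. ACM 21 (1974), §2–3
  (traces; Theorem 1: the cost of an optimal trace is the edit distance).
* K. Bringmann, M. Künnemann, *Quadratic conditional lower bounds for string problems and dynamic
  time warping*, FOCS 2015 (arXiv:1502.01063), §5.2, Facts 5.5 and 5.7.

## Design

Everything is derived from the three equations `editDist_nil_left`, `editDist_nil_right`,
`editDist_cons_cons` by the functional induction principle `editDist.induct`; no notion of trace
or alignment is introduced here. The splitting lemma is the structural substitute for "consider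
an optimal traversal and cut it where `y₁` ends".
-/

namespace Literature.Computability.Cryptography

variable {α : Type*} [DecidableEq α]

/-! ### One-symbol perturbations -/

/-- Deleting the new head first: `editDist (a :: x) y ≤ editDist x y + 1`. [folklore] -/
theorem editDist_cons_left_le (a : α) (x y : List α) :
    editDist (a :: x) y ≤ editDist x y + 1 := by
  cases y with
  | nil => simp
  | cons b y => rw [editDist_cons_cons]; exact min_le_left _ _

/-- Inserting the new head first: `editDist x (b :: y) ≤ editDist x y + 1`. [folklore] -/
theorem editDist_cons_right_le (b : α) (x y : List α) :
    editDist x (b :: y) ≤ editDist x y + 1 := by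
  cases x with
  | nil => simp
  | cons a x => rw [editDist_cons_cons]; exact (min_le_right _ _).trans (min_le_left _ _)

/-- Pairing the two heads: `editDist (a :: x) (b :: y) ≤ editDist x y + 1`. [folklore] -/
theorem editDist_cons_cons_le (a b : α) (x y : List α) :
    editDist (a :: x) (b :: y) ≤ editDist x y + 1 := by
  rw [editDist_cons_cons]
  refine (min_le_right _ _).trans ((min_le_right _ _).trans ?_)
  split_ifs <;> omega

/-- Removing the head of the second list changes the distance by at most one:
`editDist x y ≤ editDist x (b :: y) + 1` (Bringmann–Künnemann, FOCS 2015, Fact 5.5(3) for one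
symbol). [cite: BringmannKunnemannFOCS2015, Fact 5.5(3)] -/
theorem editDist_le_cons_right (b : α) (x y : List α) :
    editDist x y ≤ editDist x (b :: y) + 1 := by
  induction x with
  | nil => simp only [editDist_nil_left, List.length_cons]; omega
  | cons a x ih =>
      rw [editDist_cons_cons]
      have h1 := editDist_cons_left_le a x y
      split_ifs <;> omega

/-- Removing the head of the first list changes the distance by at most one:
`editDist x y ≤ editDist (a :: x) y + 1` (BK15, Fact 5.5(3) for one symbol).
[cite: BringmannKunnemannFOCS2015, Fact 5.5(3)] -/
theorem editDist_le_cons_left (a : α) (x y : List α) :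
    editDist x y ≤ editDist (a :: x) y + 1 := by
  induction y with
  | nil => simp only [editDist_nil_right, List.length_cons]; omega
  | cons b y ih =>
      rw [editDist_cons_cons]
      have h1 := editDist_cons_right_le b x y
      split_ifs <;> omega

/-- Equal heads can be matched greedily: `editDist (a :: x) (a :: y) = editDist x y`
(Bringmann–Künnemann, FOCS 2015, Fact 5.5(1), one symbol). [cite: BringmannKunnemannFOCS2015, Fact 5.5(1)] -/
theorem editDist_cons_cons_same (a : α) (x y : List α) :
    editDist (a :: x) (a :: y) = editDist x y := by
  rw [editDist_cons_cons, if_pos rfl]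
  have h1 := editDist_le_cons_right a x y
  have h2 := editDist_le_cons_left a x y
  omega

/-- A common prefix can be matched greedily: `editDist (p ++ x) (p ++ y) = editDist x y`; in
particular `editDist (1^k x) (1^k y) = editDist x y` (Bringmann–Künnemann, FOCS 2015, Fact 5.5(1)).
[cite: BringmannKunnemannFOCS2015, Fact 5.5(1)] -/
theorem editDist_append_left_cancel (p x y : List α) :
    editDist (p ++ x) (p ++ y) = editDist x y := by
  induction p with
  | nil => rfl
  | cons a p ih => rw [List.cons_append, List.cons_append, editDist_cons_cons_same, ih]

/-- Length lower bound: `|x| ≤ editDist x y + |y|` (at least `|x| - |y|` deletions in `x`;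
Bringmann–Künnemann, FOCS 2015, Fact 5.5(2)). [cite: BringmannKunnemannFOCS2015, Fact 5.5(2)] -/
theorem length_le_editDist_add_length_right (x y : List α) :
    x.length ≤ editDist x y + y.length := by
  induction x, y using editDist.induct with
  | case1 l => simp
  | case2 a xs => simp
  | case3 a xs b ys ih1 ih2 ih3 =>
      simp only [editDist_cons_cons, List.length_cons] at *
      split_ifs at * <;> omega

/-- Length lower bound: `|y| ≤ editDist x y + |x|` (at least `|y| - |x|` deletions in `y`;
BK15, Fact 5.5(2)). [cite: BringmannKunnemannFOCS2015, Fact 5.5(2)] -/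
theorem length_le_editDist_add_length_left (x y : List α) :
    y.length ≤ editDist x y + x.length := by
  induction x, y using editDist.induct with
  | case1 l => simp
  | case2 a xs => simp
  | case3 a xs b ys ih1 ih2 ih3 =>
      simp only [editDist_cons_cons, List.length_cons] at *
      split_ifs at * <;> omega

/-! ### Symmetry (discharge of `editDist_comm`) -/

/-- The edit distance is symmetric (Wagner–Fischer 1974, §2): the recursion is symmetric under
swapping the two lists. Discharges the named fact `editDist_comm` of `SequenceProblems`.
[cite: WagnerFischer1974, §2] -/
theorem editDist_comm_holds : (editDist_comm (α := α)) := by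
  intro l₁ l₂
  induction l₁, l₂ using editDist.induct with
  | case1 l => simp
  | case2 a xs => simp
  | case3 a xs b ys ih1 ih2 ih3 =>
      rw [editDist_cons_cons, editDist_cons_cons, ih1, ih2, ih3]
      by_cases hab : a = b
      · subst hab; simp only [if_true]; omega
      · rw [if_neg hab, if_neg (Ne.symm hab)]; omega

/-- Symmetry of `editDist`, usable form. [cite: WagnerFischer1974, §2] -/
theorem editDist_comm' (x y : List α) : editDist x y = editDist y x :=
  editDist_comm_holds x y

/-! ### Concatenation -/

/-- Prepending `y₁` to the second list costs at most `|y₁|` insertions: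
`editDist x (y₁ ++ y₂) ≤ |y₁| + editDist x y₂`. [folklore] -/
theorem editDist_append_right_le (x y₁ y₂ : List α) :
    editDist x (y₁ ++ y₂) ≤ y₁.length + editDist x y₂ := by
  induction y₁ with
  | nil => simp
  | cons b y₁ ih =>
      have := editDist_cons_right_le b x (y₁ ++ y₂)
      simp only [List.cons_append, List.length_cons]; omega

/-- Prepending `x₁` to the first list costs at most `|x₁|` deletions:
`editDist (x₁ ++ x₂) y ≤ |x₁| + editDist x₂ y`. [folklore] -/
theorem editDist_append_left_le (x₁ x₂ y : List α) :
    editDist (x₁ ++ x₂) y ≤ x₁.length + editDist x₂ y := by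
  induction x₁ with
  | nil => simp
  | cons a x₁ ih =>
      have := editDist_cons_left_le a (x₁ ++ x₂) y
      simp only [List.cons_append, List.length_cons]; omega

/-- **Traversals concatenate**: `editDist (x₁ ++ x₂) (y₁ ++ y₂) ≤ editDist x₁ y₁ + editDist x₂ y₂`
(the easy half of Bringmann–Künnemann, FOCS 2015, Fact 5.7). [cite: BringmannKunnemannFOCS2015, Fact 5.7] -/
theorem editDist_append_append_le (x₁ y₁ x₂ y₂ : List α) :
    editDist (x₁ ++ x₂) (y₁ ++ y₂) ≤ editDist x₁ y₁ + editDist x₂ y₂ := by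
  induction x₁, y₁ using editDist.induct with
  | case1 l => simpa using editDist_append_right_le x₂ l y₂
  | case2 a xs =>
      simpa using editDist_append_left_le (a :: xs) x₂ y₂
  | case3 a xs b ys ih1 ih2 ih3 =>
      simp only [List.cons_append] at *
      rw [editDist_cons_cons, editDist_cons_cons]
      split_ifs at * <;> omega

/-- Appending `z` to the first list changes the distance by at most `|z|`, upper half:
`editDist (x ++ z) y ≤ editDist x y + |z|` (BK15, Fact 5.5(3)). [cite: BringmannKunnemannFOCS2015, Fact 5.5(3)] -/
theorem editDist_append_le_add_length (x z y : List α) :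
    editDist (x ++ z) y ≤ editDist x y + z.length := by
  have h := editDist_append_append_le x y z ([] : List α)
  simp only [List.append_nil, editDist_nil_right] at h
  exact h

/-! ### Splitting (Bringmann–Künnemann, Fact 5.7) -/

omit [DecidableEq α] in
/-- A three-way minimum of naturals is one of its arguments. [folklore] -/
private theorem min3_cases (A B C : ℕ) :
    min A (min B C) = A ∨ min A (min B C) = B ∨ min A (min B C) = C := by
  omega

/-- **Splitting an optimal traversal** (Bringmann–Künnemann, FOCS 2015, Fact 5.7 for two blocks):
for all `x, y₁, y₂` there is a decomposition `x = x₁ ++ x₂` with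
`editDist x₁ y₁ + editDist x₂ y₂ ≤ editDist x (y₁ ++ y₂)` (hence equality for the minimising
decomposition, by `editDist_append_append_le`). Proof by induction along the recursion: each of
the three branches of `editDist (a :: xs) (b :: ys ++ y₂)` extends a decomposition supplied by the
induction hypothesis. [cite: BringmannKunnemannFOCS2015, Fact 5.7] -/
theorem exists_split_editDist_le (x y₁ y₂ : List α) :
    ∃ x₁ x₂ : List α, x₁ ++ x₂ = x ∧ editDist x₁ y₁ + editDist x₂ y₂ ≤ editDist x (y₁ ++ y₂) := by
  induction x, y₁ using editDist.induct with
  | case1 l => exact ⟨[], [], rfl, by simp⟩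
  | case2 a xs => exact ⟨[], a :: xs, rfl, by simp⟩
  | case3 a xs b ys ih1 ih2 ih3 =>
      obtain ⟨u₁, u₂, hu, hu'⟩ := ih1
      obtain ⟨v₁, v₂, hv, hv'⟩ := ih2
      obtain ⟨w₁, w₂, hw, hw'⟩ := ih3
      simp only [List.cons_append] at *
      rw [editDist_cons_cons]
      rcases min3_cases (editDist xs (b :: (ys ++ y₂)) + 1) (editDist (a :: xs) (ys ++ y₂) + 1)
          (editDist xs (ys ++ y₂) + if a = b then 0 else 1) with h | h | h <;> rw [h]
      · -- branch 1: delete `a`; extend the decomposition of `xs` w.r.t. `b :: ys`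
        refine ⟨a :: u₁, u₂, by simp [hu], ?_⟩
        have := editDist_cons_left_le a u₁ (b :: ys)
        omega
      · -- branch 2: insert `b`; keep the decomposition of `a :: xs` w.r.t. `ys`
        refine ⟨v₁, v₂, hv, ?_⟩
        have := editDist_cons_right_le b v₁ ys
        omega
      · -- branch 3: pair `a` with `b`; extend the decomposition of `xs` w.r.t. `ys`
        refine ⟨a :: w₁, w₂, by simp [hw], ?_⟩
        have h3 : editDist (a :: w₁) (b :: ys) ≤ editDist w₁ ys + if a = b then 0 else 1 := by
          cases w₁ with
          | nil =>
              by_cases hab : a = b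
              · subst hab; simp [editDist_cons_cons]
              · simp only [editDist_nil_left, if_neg hab]
                have := editDist_cons_cons_le a b [] ys
                simpa using this
          | cons c w₁ =>
              rw [editDist_cons_cons]
              exact (min_le_right _ _).trans (min_le_right _ _)
        omega

/-- **Splitting along a block decomposition** (Bringmann–Künnemann, FOCS 2015, Fact 5.7): if the
second list is a concatenation of blocks `ys = [y₁, …, y_k]` with `k ≥ 1`, then the first list
decomposes as `x = x₁ ++ ⋯ ++ x_k` (an "ordered partition into `k` substrings", possibly empty) with
`∑ editDist xᵢ yᵢ ≤ editDist x (y₁ ++ ⋯ ++ y_k)`; with `editDist_append_append_le` this is the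
printed identity `editDist x y = min over ordered partitions of ∑ editDist x(yⱼ) yⱼ`.
[cite: BringmannKunnemannFOCS2015, Fact 5.7] -/
theorem exists_splits_editDist_le (ys : List (List α)) (hys : ys ≠ []) (x : List α) :
    ∃ xs : List (List α), xs.length = ys.length ∧ xs.flatten = x ∧
      (List.zipWith editDist xs ys).sum ≤ editDist x ys.flatten := by
  induction ys generalizing x with
  | nil => exact absurd rfl hys
  | cons y ys ih =>
      rcases ys with _ | ⟨y', ys'⟩
      · exact ⟨[x], by simp, by simp, by simp⟩
      · obtain ⟨x₁, x₂, hx, hle⟩ := exists_split_editDist_le x y (y' :: ys').flatten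
        obtain ⟨xs, hlen, hflat, hsum⟩ := ih (List.cons_ne_nil _ _) x₂
        refine ⟨x₁ :: xs, by simp [hlen], by simp [hflat, hx], ?_⟩
        simp only [List.zipWith_cons_cons, List.sum_cons, List.flatten_cons] at *
        omega

/-! ### The recursion at the ends, and reversal -/

/-- Edit distance to a one-letter list: `|w| - 1` if the letter occurs in `w` (keep one
occurrence, delete the rest), else `max |w| 1` (substitute one symbol, or insert into `[]`).
[folklore] -/
theorem editDist_singleton_right (w : List α) (b : α) :
    editDist w [b] = if b ∈ w then w.length - 1 else max w.length 1 := by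
  induction w with
  | nil => simp
  | cons c w ih =>
      rw [editDist_cons_cons, editDist_nil_right, editDist_nil_right, ih]
      by_cases hbw : b ∈ w
      · have hw : 1 ≤ w.length := List.length_pos_of_mem hbw
        have hmem : b ∈ c :: w := List.mem_cons_of_mem c hbw
        rw [if_pos hbw, if_pos hmem]
        simp only [List.length_cons]
        split_ifs <;> omega
      · by_cases hcb : c = b
        · have hmem : b ∈ c :: w := hcb ▸ List.mem_cons_self
          rw [if_neg hbw, if_pos hmem, if_pos hcb]
          simp only [List.length_cons]
          omega
        · have hmem : b ∉ c :: w := by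
            simp only [List.mem_cons, not_or]; exact ⟨fun h => hcb h.symm, hbw⟩
          rw [if_neg hbw, if_neg hmem, if_neg hcb]
          simp only [List.length_cons]
          omega

/-- **The Wagner–Fischer recursion at the ends of the lists**:
`editDist (x ++ [a]) (y ++ [b]) = min (editDist x (y ++ [b]) + 1) (min (editDist (x ++ [a]) y + 1)
(editDist x y + [a ≠ b]))` (Wagner–Fischer 1974, Thm. 2, in its original orientation; our
`editDist` recurses on the heads). The upper bounds are concatenations of traversals; the lower
bound splits an optimal traversal of `(x ++ [a], y ++ [b])` where `y` ends
(`exists_split_editDist_le`) and inspects the piece facing `[b]` (`editDist_singleton_right`).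
[cite: WagnerFischer1974, Thm. 2] -/
theorem editDist_concat_concat (x y : List α) (a b : α) :
    editDist (x ++ [a]) (y ++ [b]) =
      min (editDist x (y ++ [b]) + 1)
        (min (editDist (x ++ [a]) y + 1) (editDist x y + if a = b then 0 else 1)) := by
  apply le_antisymm
  · -- three upper bounds by concatenation
    have h1 : editDist (x ++ [a]) (y ++ [b]) ≤ editDist x (y ++ [b]) + 1 := by
      have := editDist_append_append_le x (y ++ [b]) [a] []
      simpa using this
    have h2 : editDist (x ++ [a]) (y ++ [b]) ≤ editDist (x ++ [a]) y + 1 := by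
      have := editDist_append_append_le (x ++ [a]) y [] [b]
      simpa using this
    have h3 : editDist (x ++ [a]) (y ++ [b]) ≤ editDist x y + if a = b then 0 else 1 := by
      have := editDist_append_append_le x y [a] [b]
      have hab : editDist [a] [b] = if a = b then 0 else 1 := by
        rw [editDist_cons_cons, editDist_nil_left, editDist_nil_right, editDist_nil_left]
        simp only [List.length_singleton, List.length_nil]
        split_ifs <;> omega
      rw [hab] at this
      exact this
    exact le_min h1 (le_min h2 h3)
  · -- lower bound by splitting where `y` ends
    obtain ⟨x₁, x₂, hx, hle⟩ := exists_split_editDist_le (x ++ [a]) y [b]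
    rcases List.eq_nil_or_concat x₂ with rfl | ⟨u, c, rfl⟩
    · -- `x₂ = []`: the whole of `x ++ [a]` faces `y`, and `[b]` is inserted
      rw [List.append_nil] at hx
      rw [hx, editDist_nil_left, List.length_singleton] at hle
      exact (min_le_right _ _).trans ((min_le_left _ _).trans hle)
    · -- `x₂ = u ++ [c]`: then `c = a` and `x = x₁ ++ u`
      have hx' : x₁ ++ u ++ [c] = x ++ [a] := by simpa [List.append_assoc] using hx
      obtain ⟨hxu, hca⟩ := List.append_inj' hx' rfl
      have hca : c = a := by simpa using hca
      subst hca
      subst hxu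
      rw [List.concat_eq_append] at hle
      -- `hle : editDist x₁ y + editDist (u ++ [c]) [b] ≤ editDist (x₁ ++ u ++ [c]) (y ++ [b])`;
      -- compare with branch 1 (`u` faces `[b]`) and branch 3 (`u` deleted, `c` paired with `b`)
      have hs := editDist_singleton_right (u ++ [c]) b
      have hu' := editDist_singleton_right u b
      have hb1 : editDist (x₁ ++ u) (y ++ [b]) ≤ editDist x₁ y + editDist u [b] :=
        editDist_append_append_le x₁ y u [b]
      have hb3 : editDist (x₁ ++ u) y ≤ editDist x₁ y + u.length := by
        simpa using editDist_append_append_le x₁ y u []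
      by_cases hbu : b ∈ u
      · have h1 : editDist (u ++ [c]) [b] = u.length := by
          rw [hs, if_pos (List.mem_append.2 (Or.inl hbu))]; simp
        have h2 : editDist u [b] = u.length - 1 := by rw [hu', if_pos hbu]
        have hu : 1 ≤ u.length := List.length_pos_of_mem hbu
        refine (min_le_left _ _).trans ?_
        omega
      · by_cases hcb : c = b
        · have h1 : editDist (u ++ [c]) [b] = u.length := by
            rw [hs, if_pos (List.mem_append.2 (Or.inr (by simp [hcb])))]; simp
          rw [if_pos hcb]
          refine (min_le_right _ _).trans ((min_le_right _ _).trans ?_)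
          omega
        · have hnot : b ∉ u ++ [c] := by
            simp only [List.mem_append, List.mem_singleton, not_or]
            exact ⟨hbu, fun h => hcb h.symm⟩
          have h1 : editDist (u ++ [c]) [b] = u.length + 1 := by
            rw [hs, if_neg hnot]; simp
          rw [if_neg hcb]
          refine (min_le_right _ _).trans ((min_le_right _ _).trans ?_)
          omega

/-- **Reversal invariance**: `editDist x.reverse y.reverse = editDist x y` (a trace read backwards
is a trace; Wagner–Fischer 1974, §2). With it every statement about prefixes has a mirror image
about suffixes ("we obtain symmetric statements by reversing all involved strings",
Bringmann–Künnemann, FOCS 2015, §5.2). [cite: WagnerFischer1974, §2] -/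
theorem editDist_reverse (x y : List α) : editDist x.reverse y.reverse = editDist x y := by
  induction x, y using editDist.induct with
  | case1 l => simp
  | case2 a xs => simp
  | case3 a xs b ys ih1 ih2 ih3 =>
      simp only [List.reverse_cons] at *
      rw [editDist_concat_concat, editDist_cons_cons, ih1, ih2, ih3]

/-- Appending a common suffix does not change the distance:
`editDist (x ++ s) (y ++ s) = editDist x y` (mirror image of `editDist_append_left_cancel`).
[cite: BringmannKunnemannFOCS2015, Fact 5.5(1)] -/
theorem editDist_append_right_cancel (x y s : List α) :
    editDist (x ++ s) (y ++ s) = editDist x y := by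
  rw [← editDist_reverse, List.reverse_append, List.reverse_append, editDist_append_left_cancel,
    editDist_reverse]

/-- Removing a suffix `z` of the first list changes the distance by at most `|z|`, lower half of
BK15 Fact 5.5(3): `editDist x y ≤ editDist (x ++ z) y + |z|`. [cite: BringmannKunnemannFOCS2015, Fact 5.5(3)] -/
theorem editDist_le_editDist_append_add_length (x z y : List α) :
    editDist x y ≤ editDist (x ++ z) y + z.length := by
  induction z using List.reverseRecOn with
  | nil => simp
  | append_singleton z c ih =>
      have h : editDist (x ++ z) y ≤ editDist (x ++ z ++ [c]) y + 1 := by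
        rw [← editDist_reverse (x ++ z) y, ← editDist_reverse (x ++ z ++ [c]) y]
        simp only [List.reverse_append, List.singleton_append, List.reverse_cons,
          List.reverse_nil, List.nil_append]
        exact editDist_le_cons_left c _ _
      simp only [List.append_assoc, List.length_append, List.length_singleton] at *
      omega

end Literature.Computability.Cryptography
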